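import Summits.QuantumFields.BalabanUV.Beta.D1BFx.ShellWindowLegs

/-!
# `BalabanUV.Beta.D1BFx.ShellWindowEnd` — road «BF-x» for binder row D1, sub-leaf C3-SHELL (part 3 of 3):
# THE WALL FROM SHELL-ℓ¹ LEG ROWS — THE END (one row per leg, base-point-averaged, along the powers, identity shape ⟹ drift)

HONEST DEPENDENCY (page 1, mandatory): continuum YM on T⁴ ⇐ BetaPertH ∧ nine spine estimates (0/9 proved); BetaPertH ⇐ (D1) ∧
(D4) ∧ CAP+tail; G-an2-4 gates asym, D1 and NE2/3/4.  HONEST FRAMING (cell contract, verbatim): «discharging `BetaPertH` makes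
Bałaban's UV stability UNCONDITIONAL — a real constructive-QFT result; it is NOT the continuum limit and NOT the Clay problem.»
THIS MODULE DISCHARGES NOTHING of the wall: [folklore] bookkeeping about ARBITRARY functions `ℤ⁴ → ℝ` and arbitrary `BubbleTransfer.Leg`
tables, composed BY NAME from parts 1–2 (`D1BFx/ShellWindowInterface`: `oneLoopDrift_of_windowSumPow_identity`, `tail_sum_le_shell`,
`window_sub_le_of_shellRows`, `windowSum_of_split`; `D1BFx/ShellWindowLegs`: `shellWindow_of_legRows`, `shellTail_of_legRows`) and
`ComposedRoad.abs_convexComb_sub_le`.  No `def`, no `Prop` mirror, no cited fact, 0 sorry.  Bookkeeping for ONE road (BF-x) to ONE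
conjunct (D1); 0 wall binders instantiated; NOT D1, NOT `BetaPertH`, NOT continuum, NOT Clay.

ABSOLUTE RULE (cell charter, verbatim): «No internally-minted statement may enter as a cited fact. Every hypothesis is either
kernel-proved in this package or a verbatim quotation of a PUBLISHED theorem with page reference. The manuscript(s) under audit are NOT
citable for their own disputed steps — they are the thing under adjudication; programme-internal (2001/route/tribunal) claims are never
citable.»  Accordingly nothing below is a statement about Bałaban's kernels; every hypothesis is a free binder on abstract families.

CONTENT.  `oneLoopDrift_of_shellLegRowsPow_identity_avg` — the binder list of `ComposedRoad.oneLoopDrift_of_composedLegInterfacePow_identity_avg`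
EXCEPT that each leg carries exactly ONE row: a designated subset `sF` of indices (first leg pointwise-good; on the complement the second
leg is — in an3's realised table every degree-6 pair has a leg of degree ≤ 3); the good legs keep the tree's POINTWISE (W2′) row on the
window and POINTWISE power tail beyond it VERBATIM, the other legs carry a SHELL row `Σ_{‖w‖∞=r+1}|· − table| ≤ S(r+1)⁴/((r+1)^b·n)` on the
window and a SHELL row WITH the scale-`n` exponential `Σ_{‖w‖∞=r+1}|·| ≤ 80S′(r+1)³(r+1)^{−b}e^{−(δ/n)(r+1)}` beyond it; conclusion
`OneLoopDrift (stepBal N Lc) (constA … (80E(1 + c/δ) + U + D) …) β⁰`, `E = Σ|c_i|R′_iS′_i`, `D = Σ|c_i|(80((A_P+B_P)S_i + R_i(A_Q+B_Q)) + R_iS_i)`.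
A pointwise row IMPLIES the corresponding shell row (`#shell ≤ 80(r+1)³`), so this END is strictly MORE GENERAL than the tree's and every
existing supplier still plugs in.  WHY: gen 3 of this unit found (evidence-grade, kit j094529/j094530 + located heuristic) that the MIXED
second difference of a block column of the B4-Sect.5 kernel grows like `log n` at block EDGES, so a degree-4 leg's pointwise row is off by
`log n` at `‖w‖∞ ≈ n` while its shell sums are not (edge layer of relative measure `(ρ/n)²`; `x³(1 + log(1/x)) ≤ 1`).
NOT HERE: that any actual leg satisfies the shell rows (analytic, a later leaf); the scalar-leg END / C3 twin (`D1BFx/ShellGradedRoad`).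
Unit `b2b-balaban-beta-d1-formalise-leaf-07` (gen 4), D1 formalisation swarm; `LEAVES-BFx.md` sub-row C3-SHELL; journal CLAIM l.11259.
-/

namespace Summit.QuantumFields.BalabanUV.Beta.D1BFx.ShellWindowEnd

open Finset
open scoped BigOperators
open Literature.Probability.LatticeModels (annulus)
open Literature.MathematicalPhysics.QuantumFieldTheory.Balaban1983to89
open Literature.MathematicalPhysics.QuantumFieldTheory.Balaban1983to89.FlowStep (HBeta)
open Literature.MathematicalPhysics.QuantumFieldTheory.Balaban1983to89.Beta
open Literature.MathematicalPhysics.QuantumFieldTheory.Balaban1983to89.Beta.TransverseStructure (E4)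
open Literature.MathematicalPhysics.QuantumFieldTheory.Balaban1983to89.Beta.LeadingCoefficient (leadingIntegrand kappaBal
  transverseValue)
open Literature.MathematicalPhysics.QuantumFieldTheory.Balaban1983to89.Beta.DyadicShell (Pt toReal supNorm mem_annulus_iff)
open Literature.MathematicalPhysics.QuantumFieldTheory.Balaban1983to89.Beta.LargeLWindow.WindowDecomposition (constA)
open Literature.MathematicalPhysics.QuantumFieldTheory.Balaban1983to89.Beta.BubbleTransfer (Leg lattBubble contBubble bubbleConst)
open Literature.MathematicalPhysics.QuantumFieldTheory.Balaban1983to89.Beta.Drift (OneLoopDrift)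
open Literature.MathematicalPhysics.QuantumFieldTheory.Balaban1983to89.Beta.MarginalTelescoping (composedCoeff IdentityForm)
open Literature.MathematicalPhysics.QuantumFieldTheory.Balaban1983to89.Beta.ComposedRoad (abs_convexComb_sub_le)
open Summit.QuantumFields.BalabanUV.Beta.D1BFx.ShellWindowInterface (oneLoopDrift_of_windowSumPow_identity tail_sum_le_shell
  window_sub_le_of_shellRows windowSum_of_split)
open Summit.QuantumFields.BalabanUV.Beta.D1BFx.ShellWindowLegs (shellWindow_of_legRows shellTail_of_legRows)

noncomputable section

/-! ## §5 THE END: one row per leg, base-point-averaged identification, along the powers, identity shape ⟹ drift -/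

section End

variable {ι : Type*} {s : Finset ι} {cc₀ : ι → ℝ} {P Q : ι → Leg} {κB : Type*}

/-- [folklore] **THE WALL FROM SHELL LEG ROWS, BASE-POINT-AVERAGED, ALONG `n = Lc^m`, IDENTITY SHAPE ⟹ DRIFT.**  The binder list of
`ComposedRoad.oneLoopDrift_of_composedLegInterfacePow_identity_avg` with ONE ROW PER LEG (designated subset `sF`: first leg pointwise-good;
on `s \ sF` the second): on the window (`‖w‖∞ = r+1 ≤ M(n)`) the pointwise (W2′) rows `hFpt`/`hGpt` for the good legs and the SHELL rows
`hGsh`/`hFsh` (`Σ_shell|· − table| ≤ S(r+1)⁴/((r+1)^b·n)`) for the others; beyond it (`r ≥ M(n)`) the pointwise power tails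
`hFtpt`/`hGtpt` for the good legs and the SHELL rows WITH the scale-`n` exponential `hGtsh`/`hFtsh` for the others; averaged
identification `hident` up to `U`; `IdentityForm` ⟹ `OneLoopDrift (stepBal N Lc) (constA … (80E(1 + c/δ) + U + D) …) β⁰`.  Strictly
more general than the tree's END (a pointwise row implies the shell row, `#shell ≤ 80(r+1)³`); nothing of Bałaban's is asserted. -/
theorem oneLoopDrift_of_shellLegRowsPow_identity_avg {β : HBeta} (S : B12Beta.OneLoopSplit β)
    (hdeg : ∀ i ∈ s, (P i).a + (Q i).a = 6) {μ ν : Fin 4} (hμν : μ ≠ ν) {N : ℝ} (hN : N ≠ 0)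
    (hval : ∀ x : E4, x ≠ 0 → x μ * x ν * contBubble s cc₀ P Q x = leadingIntegrand (kappaBal N) μ ν x)
    {Lc : ℕ} (hL : 2 ≤ Lc) {μC : ℕ → ℕ → ℝ} (sF : Finset ι)
    {F' G' : κB → ι → ℕ → Pt → ℝ} {R Sg R' S' : ι → ℝ} {δ U cc : ℝ} {M : ℕ → ℕ}
    {Bset : ℕ → Finset κB} {wt : ℕ → κB → ℝ}
    (hwt0 : ∀ n : ℕ, 2 ≤ n → ∀ b ∈ Bset n, 0 ≤ wt n b) (hwt1 : ∀ n : ℕ, 2 ≤ n → ∑ b ∈ Bset n, wt n b = 1)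
    (hR : ∀ i ∈ s, 0 ≤ R i) (hS : ∀ i ∈ s, 0 ≤ Sg i) (hR' : ∀ i ∈ s, 0 ≤ R' i) (hS' : ∀ i ∈ s, 0 ≤ S' i) (hδ : 0 < δ)
    (hc : 1 ≤ cc) (hM : ∀ L : ℕ, 2 ≤ L → 1 ≤ M L ∧ (L : ℝ) ≤ cc * M L) (hML : ∀ L : ℕ, 2 ≤ L → M L ≤ L)
    (hFpt : ∀ m : ℕ, 1 ≤ m → ∀ b ∈ Bset (Lc ^ m), ∀ w ∈ annulus 4 0 (M (Lc ^ m)), ∀ i ∈ s, i ∈ sF →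
      |F' b i (Lc ^ m) w - (P i).f (Lc ^ m) 0 w| ≤ R i / ((supNorm w : ℝ) ^ ((P i).a - 2) * ((Lc ^ m : ℕ) : ℝ) ^ 2))
    (hGsh : ∀ m : ℕ, 1 ≤ m → ∀ b ∈ Bset (Lc ^ m), ∀ r : ℕ, r + 1 ≤ M (Lc ^ m) → ∀ i ∈ s, i ∈ sF →
      ∑ w ∈ annulus 4 r (r + 1), |G' b i (Lc ^ m) w - (Q i).f (Lc ^ m) 0 w| ≤
        Sg i * ((r : ℝ) + 1) ^ 4 / (((r : ℝ) + 1) ^ (Q i).a * ((Lc ^ m : ℕ) : ℝ)))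
    (hGpt : ∀ m : ℕ, 1 ≤ m → ∀ b ∈ Bset (Lc ^ m), ∀ w ∈ annulus 4 0 (M (Lc ^ m)), ∀ i ∈ s, i ∉ sF →
      |G' b i (Lc ^ m) w - (Q i).f (Lc ^ m) 0 w| ≤ Sg i / ((supNorm w : ℝ) ^ ((Q i).a - 2) * ((Lc ^ m : ℕ) : ℝ) ^ 2))
    (hFsh : ∀ m : ℕ, 1 ≤ m → ∀ b ∈ Bset (Lc ^ m), ∀ r : ℕ, r + 1 ≤ M (Lc ^ m) → ∀ i ∈ s, i ∉ sF →
      ∑ w ∈ annulus 4 r (r + 1), |F' b i (Lc ^ m) w - (P i).f (Lc ^ m) 0 w| ≤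
        R i * ((r : ℝ) + 1) ^ 4 / (((r : ℝ) + 1) ^ (P i).a * ((Lc ^ m : ℕ) : ℝ)))
    (hFtpt : ∀ m : ℕ, 1 ≤ m → ∀ b ∈ Bset (Lc ^ m), ∀ r : ℕ, M (Lc ^ m) ≤ r → ∀ w ∈ annulus 4 r (r + 1), ∀ i ∈ s, i ∈ sF →
      |F' b i (Lc ^ m) w| ≤ R' i / ((r : ℝ) + 1) ^ (P i).a)
    (hGtsh : ∀ m : ℕ, 1 ≤ m → ∀ b ∈ Bset (Lc ^ m), ∀ r : ℕ, M (Lc ^ m) ≤ r → ∀ i ∈ s, i ∈ sF →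
      ∑ w ∈ annulus 4 r (r + 1), |G' b i (Lc ^ m) w| ≤
        80 * S' i * ((r : ℝ) + 1) ^ 3 / ((r : ℝ) + 1) ^ (Q i).a * Real.exp (-(δ / ((Lc ^ m : ℕ) : ℝ)) * ((r : ℝ) + 1)))
    (hGtpt : ∀ m : ℕ, 1 ≤ m → ∀ b ∈ Bset (Lc ^ m), ∀ r : ℕ, M (Lc ^ m) ≤ r → ∀ w ∈ annulus 4 r (r + 1), ∀ i ∈ s, i ∉ sF →
      |G' b i (Lc ^ m) w| ≤ S' i / ((r : ℝ) + 1) ^ (Q i).a)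
    (hFtsh : ∀ m : ℕ, 1 ≤ m → ∀ b ∈ Bset (Lc ^ m), ∀ r : ℕ, M (Lc ^ m) ≤ r → ∀ i ∈ s, i ∉ sF →
      ∑ w ∈ annulus 4 r (r + 1), |F' b i (Lc ^ m) w| ≤
        80 * R' i * ((r : ℝ) + 1) ^ 3 / ((r : ℝ) + 1) ^ (P i).a * Real.exp (-(δ / ((Lc ^ m : ℕ) : ℝ)) * ((r : ℝ) + 1)))
    (hident : ∀ m : ℕ, 1 ≤ m → ∃ R₀ : ℕ, M (Lc ^ m) ≤ R₀ ∧
      |composedCoeff μC m - ∑ b ∈ Bset (Lc ^ m), wt (Lc ^ m) b * ∑ w ∈ annulus 4 0 R₀, toReal w μ * toReal w ν *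
        ∑ i ∈ s, cc₀ i * (F' b i (Lc ^ m) w * G' b i (Lc ^ m) w)| ≤ U)
    (hid : IdentityForm μC S.β0) :
    OneLoopDrift (B12Normalization.stepBal N Lc)
      (constA (|kappaBal N| * 24 + |kappaBal N| * 110592) (bubbleConst s cc₀ P Q)
          (80 * (∑ i ∈ s, |cc₀ i| * (R' i * S' i)) * (1 + cc / δ) + U +
            ∑ i ∈ s, |cc₀ i| * (80 * (((P i).A + (P i).B) * Sg i + R i * ((Q i).A + (Q i).B)) + R i * Sg i))
          cc (kappaBal N * transverseValue)) S.β0 := by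
  classical
  set E : ℝ := ∑ i ∈ s, |cc₀ i| * (R' i * S' i) with hEdef
  set D : ℝ := ∑ i ∈ s, |cc₀ i| * (80 * (((P i).A + (P i).B) * Sg i + R i * ((Q i).A + (Q i).B)) + R i * Sg i) with hDdef
  have hE : 0 ≤ E := Finset.sum_nonneg fun i hi => mul_nonneg (abs_nonneg _) (mul_nonneg (hR' i hi) (hS' i hi))
  have hD : 0 ≤ D := by
    refine Finset.sum_nonneg fun i hi => mul_nonneg (abs_nonneg _) ?_
    have := (P i).nonneg_A; have := (P i).nonneg_B; have := (Q i).nonneg_A; have := (Q i).nonneg_B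
    have := hR i hi; have := hS i hi
    positivity
  refine oneLoopDrift_of_windowSumPow_identity S hdeg hμν hN hval hL hc hM hML (fun m hm => ?_) hid
  -- at `n = Lc^m`
  set n : ℕ := Lc ^ m with hndef
  have hn2 : 2 ≤ n := hL.trans (hndef ▸ Nat.le_self_pow (by omega) Lc)
  have hn1 : 1 ≤ n := by omega
  obtain ⟨hM1, hLM⟩ := hM n hn2
  have hMn : M n ≤ n := hML n hn2
  let Kb : κB → Pt → ℝ := fun b w => toReal w μ * toReal w ν * ∑ i ∈ s, cc₀ i * (F' b i n w * G' b i n w)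
  let K0 : Pt → ℝ := fun w => toReal w μ * toReal w ν * lattBubble s cc₀ P Q n 0 w
  -- per base point: in-window comparison `D`
  have hwin : ∀ b ∈ Bset n, |∑ w ∈ annulus 4 0 (M n), Kb b w - ∑ w ∈ annulus 4 0 (M n), K0 w| ≤ D := by
    intro b hb
    refine window_sub_le_of_shellRows hD hn1 hMn fun r hr => ?_
    have hrn : r + 1 ≤ n := hr.trans hMn
    have e : ∀ w, Kb b w - K0 w =
        toReal w μ * toReal w ν * ∑ i ∈ s, cc₀ i * (F' b i n w * G' b i n w - (P i).f n 0 w * (Q i).f n 0 w) := by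
      intro w
      simp only [Kb, K0, lattBubble, ← mul_sub, ← Finset.sum_sub_distrib]
    simp_rw [e]
    have hsub : ∀ w ∈ annulus 4 r (r + 1), w ∈ annulus 4 0 (M n) := fun w hw => by
      rw [mem_annulus_iff] at hw ⊢
      omega
    exact shellWindow_of_legRows hdeg μ ν sF hrn hR hS (fun i hi hiF w hw => hFpt m hm b hb w (hsub w hw) i hi hiF)
      (fun i hi hiF => hGsh m hm b hb r hr i hi hiF) (fun i hi hiF w hw => hGpt m hm b hb w (hsub w hw) i hi hiF)
      (fun i hi hiF => hFsh m hm b hb r hr i hi hiF)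
  -- per base point: the tail `80E(1 + c/δ)`
  have htail : ∀ b ∈ Bset n, ∀ R₁ : ℕ, M n ≤ R₁ → |∑ w ∈ annulus 4 (M n) R₁, Kb b w| ≤ 80 * E * (1 + cc / δ) := by
    intro b hb R₁ hR₁
    refine tail_sum_le_shell hE hδ hn1 hM1 hLM hR₁ fun r hr => ?_
    exact shellTail_of_legRows hdeg μ ν sF hR' hS' (fun i hi hiF w hw => hFtpt m hm b hb r hr w hw i hi hiF)
      (fun i hi hiF => hGtsh m hm b hb r hr i hi hiF) (fun i hi hiF w hw => hGtpt m hm b hb r hr w hw i hi hiF)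
      (fun i hi hiF => hFtsh m hm b hb r hr i hi hiF)
  -- per base point: the split; then average and add the identification
  obtain ⟨R₀, hR₀, hU⟩ := hident m hm
  have hsplit : ∀ b ∈ Bset n, |∑ w ∈ annulus 4 0 R₀, Kb b w - ∑ w ∈ annulus 4 0 (M n), K0 w| ≤
      80 * E * (1 + cc / δ) + 0 + D := fun b hb =>
    windowSum_of_split (hwin b hb) (htail b hb) ⟨R₀, hR₀, by simp⟩
  have havg : |∑ b ∈ Bset n, wt n b * ∑ w ∈ annulus 4 0 R₀, Kb b w - ∑ w ∈ annulus 4 0 (M n), K0 w| ≤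
      80 * E * (1 + cc / δ) + 0 + D := abs_convexComb_sub_le (hwt0 n hn2) (hwt1 n hn2) hsplit
  calc |composedCoeff μC m - ∑ w ∈ annulus 4 0 (M n), K0 w|
      = |(composedCoeff μC m - ∑ b ∈ Bset n, wt n b * ∑ w ∈ annulus 4 0 R₀, Kb b w) +
          (∑ b ∈ Bset n, wt n b * ∑ w ∈ annulus 4 0 R₀, Kb b w - ∑ w ∈ annulus 4 0 (M n), K0 w)| := by ring_nf
    _ ≤ |composedCoeff μC m - ∑ b ∈ Bset n, wt n b * ∑ w ∈ annulus 4 0 R₀, Kb b w| +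
          |∑ b ∈ Bset n, wt n b * ∑ w ∈ annulus 4 0 R₀, Kb b w - ∑ w ∈ annulus 4 0 (M n), K0 w| := abs_add_le _ _
    _ ≤ U + (80 * E * (1 + cc / δ) + 0 + D) := add_le_add hU havg
    _ = 80 * E * (1 + cc / δ) + U + D := by ring

end End

end

end Summit.QuantumFields.BalabanUV.Beta.D1BFx.ShellWindowEnd
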